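import Summits.AtomisticToContinuum.BoseEinsteinCondensation.Theses.BECConjugateDomination
import Summits.AtomisticToContinuum.BoseEinsteinCondensation.Theorems.BECConjugateDominationInfraredMinimumUncertaintyFSum
import Mathlib.Algebra.QuadraticDiscriminant
import HarnessLib

/-!
# The second-moment floor `m₁² ≤ m₀ m₂`: stub `stub_secondMomentFloor` of line
# `third-law-current-floor` for crux `BECConjugateDomination.HardCoreExtension` (stmt-AtomisticToContinuum-11786)

Stub S1 of the skeleton `Cruxes/HardCoreExtension/Lines/third-law-current-floor.lean` (supports, does not
close, stmt-AtomisticToContinuum-11786). For a REAL periodic `C¹` state `Ψ = u` of `N = n+1` bosons on the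
torus of side `L > 0` and a mode `m ∈ ℤ³∖0`, `k = 2πm/L` (`waveVec L m`), with the density mode
`Z = ∑ⱼ e_m(xⱼ)` (`densityMode`), the longitudinal current amplitude `B = ∑ⱼ e_m(xⱼ)(k·∇ⱼ)u`,
`M₀ = ∫_{cell^N} |Z|²u²` (`= N S_m`), `D = ∫_{cell^N} |B|²` and `κ = ‖k‖²`:

  `(N κ)² ≤ M₀ · (4 D + N κ² (2 − M₀/N))`, equivalently `κ² (N − M₀)² ≤ 4 M₀ D`.

Proof (the engine of the line, exact for every real state — no minimality, no potential):
* `two_mul_crossIntegral`: the f-sum content. Summing the per-particle periodic integration by parts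
  `fsum_stepB` (file `…InfraredMinimumUncertaintyFSum`) over `j` and using `∑ⱼ Re(Z̄ eⱼ) = |Z|²`:
  `2 J = κ (N ∫u² − M₀)` for the cross term `J = ∫ Im(Z̄ u B)`;
* `quadForm_nonneg`: for real `s`, `0 ≤ ∫ |s Z u − 2iB|² = M₀ s² + 4 J s + 4 D` (pointwise expansion
  `normSq_expand`, linearity of the Bochner integral over the bounded cell);
* `discrim_le_zero`: `(4J)² ≤ 16 M₀ D`, i.e. Cauchy–Schwarz `J² ≤ M₀ D`; with `∫u² = 1` this is the claim.
(`A = κ Z u − 2iB = [H, ρ_k]Ψ` is the commutator amplitude; `Re⟨ZΨ, A⟩ = Nκ` is the f-sum rule of one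
state and `‖A‖² = 4D + Nκ²(2 − S)`; the discriminant in `s = κ − t` of `∫|A − tZu|² ≥ 0` is the same.)

References: Pines–Nozières I (1966) §2.4 and Stringari 1995 §2.3 (f-sum rule, moments `m₀, m₁`);
Lipparini 2008 §8.4; Bakry–Gentil–Ledoux 2014 §1.11.3 (integration by parts on the torus).
-/

noncomputable section

namespace Summit.AtomisticToContinuum.BoseEinsteinCondensation.Cruxes.HardCoreExtension.ThirdLawCurrentFloor

open MeasureTheory Filter
open scoped ENNReal NNReal BigOperators ComplexConjugate
open Literature.MathematicalPhysics.QuantumManyBody.BoseGas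
open Summit.AtomisticToContinuum.BoseEinsteinCondensation.Cruxes.InfraredMinimumUncertainty.FisherGaussianDensityMode
open Summit.AtomisticToContinuum.BoseEinsteinCondensation.Theorems.StaticResponseBound.Negative
  (integral_norm_sq_eq_one)

namespace SecondMomentFloor

variable {N : ℕ} {L : ℝ}

/-- `Im(w u · e d) = u d Im(w e)` for real `u, d`. [folklore] -/
theorem im_mul_ofReal_mul (w e : ℂ) (u d : ℝ) :
    (w * (u : ℂ) * (e * (d : ℂ))).im = u * d * (w * e).im := by
  simp only [Complex.mul_im, Complex.mul_re, Complex.ofReal_re, Complex.ofReal_im]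
  ring

/-- Pointwise expansion `|s Z u − 2iB|² = |Z|²u² s² + 4 Im(Z̄ u B) s + 4|B|²` (real `u, s`). [folklore] -/
theorem normSq_expand (Z B : ℂ) (u s : ℝ) :
    ‖(s : ℂ) * (Z * (u : ℂ)) - 2 * Complex.I * B‖ ^ 2 =
      (s * s) * (‖Z‖ ^ 2 * u ^ 2) + (4 * s) * (conj Z * (u : ℂ) * B).im + 4 * ‖B‖ ^ 2 := by
  rw [Complex.sq_norm, Complex.sq_norm, Complex.sq_norm, Complex.normSq_apply, Complex.normSq_apply,
    Complex.normSq_apply]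
  simp only [Complex.sub_re, Complex.sub_im, Complex.mul_re, Complex.mul_im, Complex.ofReal_re,
    Complex.ofReal_im, Complex.I_re, Complex.I_im, Complex.conj_re, Complex.conj_im, Complex.re_ofNat,
    Complex.im_ofNat]
  ring

/-- `∑ⱼ u² Re(Z̄ e_m(xⱼ)) = |Z|² u²` for the density mode `Z = ∑ⱼ e_m(xⱼ)`. [folklore] -/
theorem sum_sq_mul_re_conj_densityMode_mul (L : ℝ) (m : Fin 3 → ℤ) (X : Config N) (u : ℝ) :
    ∑ j, u ^ 2 * (conj (densityMode N L m X) * cellWave L m (X j)).re =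
      ‖densityMode N L m X‖ ^ 2 * u ^ 2 := by
  rw [← Finset.mul_sum, ← Complex.re_sum, ← Finset.mul_sum,
    show ∑ j, cellWave L m (X j) = densityMode N L m X from rfl, Complex.conj_mul',
    ← Complex.ofReal_pow, Complex.ofReal_re, mul_comm]

/-- **The f-sum content, summed over the particles.** For a real `C¹` lattice-periodic `u`, the density
mode `Z` and the current amplitude `B = ∑ⱼ e_m(xⱼ) ∂_{xⱼ·k}u`:
`2 ∫ Im(Z̄ u B) = ‖k‖² (N ∫ u² − ∫ |Z|² u²)` (periodic integration by parts, `fsum_stepB`, and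
`∑ⱼ Re(Z̄ eⱼ) = |Z|²`). [folklore] -/
theorem two_mul_crossIntegral (hL : 0 < L) (m : Fin 3 → ℤ) {u : Config N → ℝ}
    (hu : ContDiff ℝ 1 u) (hper : IsLatticePeriodic L u) :
    2 * ∫ X in cellN N L, (conj (densityMode N L m X) * (u X : ℂ) *
        ∑ j, cellWave L m (X j) * ((fderiv ℝ u X (Pi.single j (waveVec L m)) : ℝ) : ℂ)).im =
      ‖waveVec L m‖ ^ 2 * ((N : ℝ) * ∫ X in cellN N L, u X ^ 2) -
        ‖waveVec L m‖ ^ 2 * ∫ X in cellN N L, ‖densityMode N L m X‖ ^ 2 * u X ^ 2 := by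
  -- continuity of the players
  have hZc : Continuous (densityMode N L m) := continuous_densityMode N L m
  have hec : ∀ j : Fin N, Continuous (fun Y : Config N => cellWave L m (Y j)) := fun j =>
    (contDiff_cellWave L m).continuous.comp (continuous_apply j)
  have huc : Continuous u := hu.continuous
  have hduc : ∀ j : Fin N, Continuous (fun Y => fderiv ℝ u Y (Pi.single j (waveVec L m))) := fun j =>
    (hu.continuous_fderiv one_ne_zero).clm_apply continuous_const
  have hFc : ∀ j : Fin N, Continuous (fun Y => (conj (densityMode N L m Y) * cellWave L m (Y j)).im) :=
    fun j => Complex.continuous_im.comp ((Complex.continuous_conj.comp hZc).mul (hec j))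
  have hRc : ∀ j : Fin N, Continuous (fun Y => (conj (densityMode N L m Y) * cellWave L m (Y j)).re) :=
    fun j => Complex.continuous_re.comp ((Complex.continuous_conj.comp hZc).mul (hec j))
  -- pointwise: the cross term is the sum of the Step-B integrands
  have hpt : ∀ X, 2 * (conj (densityMode N L m X) * (u X : ℂ) *
        ∑ j, cellWave L m (X j) * ((fderiv ℝ u X (Pi.single j (waveVec L m)) : ℝ) : ℂ)).im =
      ∑ j, 2 * u X * fderiv ℝ u X (Pi.single j (waveVec L m)) *
        (conj (densityMode N L m X) * cellWave L m (X j)).im := by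
    intro X
    rw [Finset.mul_sum, Complex.im_sum, Finset.mul_sum]
    refine Finset.sum_congr rfl fun j _ => ?_
    rw [im_mul_ofReal_mul]
    ring
  have hI₁ : ∀ j : Fin N, Integrable (fun X => 2 * u X * fderiv ℝ u X (Pi.single j (waveVec L m)) *
      (conj (densityMode N L m X) * cellWave L m (X j)).im) (volume.restrict (cellN N L)) := fun j =>
    integrableOn_cellN (((continuous_const.mul huc).mul (hduc j)).mul (hFc j)) L
  have hI₂ : ∀ j : Fin N, Integrable (fun X => u X ^ 2 * (conj (densityMode N L m X) * cellWave L m (X j)).re)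
      (volume.restrict (cellN N L)) := fun j => integrableOn_cellN ((huc.pow 2).mul (hRc j)) L
  rw [← integral_const_mul]
  simp_rw [hpt]
  rw [integral_finsetSum _ fun j _ => hI₁ j]
  simp_rw [fsum_stepB hL m hu hper]
  rw [Finset.sum_sub_distrib, Finset.sum_const, Finset.card_univ, Fintype.card_fin, nsmul_eq_mul,
    ← Finset.mul_sum, ← integral_finsetSum _ fun j _ => hI₂ j]
  simp_rw [sum_sq_mul_re_conj_densityMode_mul]
  ring

/-- **Positivity of the quadratic form** `s ↦ ∫_{cell^N} |s Z u − 2iB|² = M₀ s² + 4J s + 4D ≥ 0` for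
continuous `Z, B` and real continuous `u` (`M₀ = ∫|Z|²u²`, `J = ∫ Im(Z̄ u B)`, `D = ∫|B|²`). [folklore] -/
theorem quadForm_nonneg (L : ℝ) {Z B : Config N → ℂ} {u : Config N → ℝ} (hZ : Continuous Z)
    (hB : Continuous B) (hu : Continuous u) (s : ℝ) :
    0 ≤ (∫ X in cellN N L, ‖Z X‖ ^ 2 * u X ^ 2) * (s * s) +
      (4 * ∫ X in cellN N L, (conj (Z X) * (u X : ℂ) * B X).im) * s +
        4 * ∫ X in cellN N L, ‖B X‖ ^ 2 := by
  have h1 : IntegrableOn (fun X => (s * s) * (‖Z X‖ ^ 2 * u X ^ 2)) (cellN N L) volume :=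
    (integrableOn_cellN ((hZ.norm.pow 2).mul (hu.pow 2)) L).const_mul _
  have h2 : IntegrableOn (fun X => (4 * s) * (conj (Z X) * (u X : ℂ) * B X).im) (cellN N L) volume :=
    (integrableOn_cellN (Complex.continuous_im.comp
      (((Complex.continuous_conj.comp hZ).mul (Complex.continuous_ofReal.comp hu)).mul hB)) L).const_mul _
  have h3 : IntegrableOn (fun X => 4 * ‖B X‖ ^ 2) (cellN N L) volume :=
    (integrableOn_cellN (hB.norm.pow 2) L).const_mul _
  have h0 : 0 ≤ ∫ X in cellN N L, ((s * s) * (‖Z X‖ ^ 2 * u X ^ 2) +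
      (4 * s) * (conj (Z X) * (u X : ℂ) * B X).im + 4 * ‖B X‖ ^ 2) :=
    integral_nonneg fun X => by
      have h := normSq_expand (Z X) (B X) (u X) s
      rw [← h]
      positivity
  have h12 : IntegrableOn (fun X => (s * s) * (‖Z X‖ ^ 2 * u X ^ 2) +
      (4 * s) * (conj (Z X) * (u X : ℂ) * B X).im) (cellN N L) volume := h1.add h2
  rw [integral_add h12 h3, integral_add h1 h2, integral_const_mul, integral_const_mul,
    integral_const_mul] at h0
  linarith

/-- **Cauchy–Schwarz in discriminant form**: `(4J)² ≤ 16 M₀ D`, i.e. `J² ≤ M₀ D`. [folklore] -/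
theorem crossIntegral_sq_le (L : ℝ) {Z B : Config N → ℂ} {u : Config N → ℝ} (hZ : Continuous Z)
    (hB : Continuous B) (hu : Continuous u) :
    (∫ X in cellN N L, (conj (Z X) * (u X : ℂ) * B X).im) ^ 2 ≤
      (∫ X in cellN N L, ‖Z X‖ ^ 2 * u X ^ 2) * ∫ X in cellN N L, ‖B X‖ ^ 2 := by
  have h := discrim_le_zero (quadForm_nonneg L hZ hB hu)
  rw [discrim] at h
  nlinarith [h]

end SecondMomentFloor

open SecondMomentFloor

/-- **S1 `stub_secondMomentFloor` (the second-moment floor, exact for every real periodic state).**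
For every REAL periodic `C¹` state `Ψ` of `n+1` bosons on the torus of side `L > 0` and every
`m ∈ ℤ³∖0`, with `k = 2πm/L`, `S = (n+1)⁻¹∫|∑ⱼ e_m(xⱼ)|²|Ψ|²` and `D = ∫|∑ⱼ e_m(xⱼ)·(k·∇ⱼ)Ψ|²`:
`((n+1)‖k‖²)² ≤ ((n+1)S)·(4D + (n+1)‖k‖⁴(2 − S))` (`m₁² ≤ m₀ m₂` for the moments of the density
response of ONE state: f-sum rule by one periodic integration by parts, then Cauchy–Schwarz).
[folklore] -/
theorem stub_secondMomentFloor :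
    ∀ (n : ℕ) (L : ℝ), 0 < L → ∀ Ψ : PeriodicTrialState (n + 1) L,
      (∀ X, Ψ.ψ X = (((Ψ.ψ X).re : ℝ) : ℂ)) →
      ∀ m : Fin 3 → ℤ, m ≠ 0 →
        (((n : ℝ) + 1) * ‖(2 * Real.pi / L) • latticeVec 1 m‖ ^ 2) ^ 2 ≤
          (((n : ℝ) + 1) *
              (((n : ℝ) + 1)⁻¹ *
                ∫ X in cellN (n + 1) L,
                  ‖∑ j : Fin (n + 1), cellWave L m (X j)‖ ^ 2 * ‖Ψ.ψ X‖ ^ 2)) *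
            (4 * (∫ X in cellN (n + 1) L,
                    ‖∑ j : Fin (n + 1), cellWave L m (X j) *
                        fderiv ℝ Ψ.ψ X (Pi.single j ((2 * Real.pi / L) • latticeVec 1 m))‖ ^ 2) +
              ((n : ℝ) + 1) * ‖(2 * Real.pi / L) • latticeVec 1 m‖ ^ 4 *
                (2 - ((n : ℝ) + 1)⁻¹ *
                  ∫ X in cellN (n + 1) L,
                    ‖∑ j : Fin (n + 1), cellWave L m (X j)‖ ^ 2 * ‖Ψ.ψ X‖ ^ 2)) := by
  intro n L hL Ψ hreal m _hm
  rw [show (2 * Real.pi / L) • latticeVec 1 m = waveVec L m from rfl]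
  -- the real amplitude `u = Re Ψ`
  set u : Config (n + 1) → ℝ := fun X => (Ψ.ψ X).re with hudef
  have hψu : ∀ X, Ψ.ψ X = ((u X : ℝ) : ℂ) := hreal
  have hu_cd : ContDiff ℝ 1 u := by
    have h₀ := Complex.reCLM.contDiff.comp Ψ.contDiff
    exact h₀
  have hu_per : IsLatticePeriodic L u := fun X i c => by
    show (Ψ.ψ (X + Pi.single i (EuclideanSpace.single c L))).re = (Ψ.ψ X).re
    rw [Ψ.periodic X i c]
  have hfun : Ψ.ψ = fun X => ((u X : ℝ) : ℂ) := funext hψu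
  have hderiv : ∀ X (v : Config (n + 1)), fderiv ℝ Ψ.ψ X v = ((fderiv ℝ u X v : ℝ) : ℂ) := by
    intro X v
    have h₁ := Complex.ofRealCLM.hasFDerivAt.comp X ((hu_cd.differentiable one_ne_zero) X).hasFDerivAt
    have h₂ : HasFDerivAt Ψ.ψ (Complex.ofRealCLM.comp (fderiv ℝ u X)) X := by
      rw [hfun]; exact h₁
    rw [h₂.fderiv, ContinuousLinearMap.comp_apply, Complex.ofRealCLM_apply]
  -- the players `Z`, `B` and the three integrals `M₀`, `D`, `J`
  set B : Config (n + 1) → ℂ := fun X =>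
    ∑ j, cellWave L m (X j) * ((fderiv ℝ u X (Pi.single j (waveVec L m)) : ℝ) : ℂ) with hBdef
  have hptM : ∀ X, ‖∑ j : Fin (n + 1), cellWave L m (X j)‖ ^ 2 * ‖Ψ.ψ X‖ ^ 2 =
      ‖densityMode (n + 1) L m X‖ ^ 2 * u X ^ 2 := fun X => by
    rw [hψu X, Complex.norm_real, Real.norm_eq_abs, sq_abs]
    rfl
  have hptD : ∀ X, ‖∑ j : Fin (n + 1), cellWave L m (X j) *
      fderiv ℝ Ψ.ψ X (Pi.single j (waveVec L m))‖ ^ 2 = ‖B X‖ ^ 2 := fun X => by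
    simp only [hBdef, hderiv]
  simp_rw [hptM, hptD]
  set M₀ : ℝ := ∫ X in cellN (n + 1) L, ‖densityMode (n + 1) L m X‖ ^ 2 * u X ^ 2 with hM₀
  set D : ℝ := ∫ X in cellN (n + 1) L, ‖B X‖ ^ 2 with hD
  set J : ℝ := ∫ X in cellN (n + 1) L, (conj (densityMode (n + 1) L m X) * (u X : ℂ) * B X).im with hJdef
  set κ : ℝ := ‖waveVec L m‖ ^ 2 with hκ
  -- `∫ u² = 1`
  have hnorm : ∫ X in cellN (n + 1) L, u X ^ 2 = 1 := by
    have h1 := integral_norm_sq_eq_one Ψ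
    have : ∀ X, ‖Ψ.ψ X‖ ^ 2 = u X ^ 2 := fun X => by
      rw [hψu X, Complex.norm_real, Real.norm_eq_abs, sq_abs]
    simp_rw [this] at h1
    exact h1
  -- the f-sum content: `2J = κ (n+1) − κ M₀`
  have hJ : 2 * J = κ * ((n : ℝ) + 1) - κ * M₀ := by
    have h := two_mul_crossIntegral hL m hu_cd hu_per
    rw [hnorm] at h
    simp only [hJdef, hκ, hM₀, hBdef]
    rw [h]
    push_cast
    ring
  -- continuity, then Cauchy–Schwarz `J² ≤ M₀ D`
  have hZc : Continuous (densityMode (n + 1) L m) := continuous_densityMode (n + 1) L m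
  have hBc : Continuous B := by
    refine continuous_finsetSum _ fun j _ => ?_
    exact ((contDiff_cellWave L m).continuous.comp (continuous_apply j)).mul
      (Complex.continuous_ofReal.comp ((hu_cd.continuous_fderiv one_ne_zero).clm_apply continuous_const))
  have hCS : J ^ 2 ≤ M₀ * D := crossIntegral_sq_le L hZc hBc hu_cd.continuous
  -- algebra
  have hN : ((n : ℝ) + 1) ≠ 0 := by positivity
  have hNinv : ((n : ℝ) + 1) * ((n : ℝ) + 1)⁻¹ = 1 := mul_inv_cancel₀ hN
  have hJ2 : (2 * J) ^ 2 = (κ * ((n : ℝ) + 1) - κ * M₀) ^ 2 := by rw [hJ]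
  have hR : ((n : ℝ) + 1) * (((n : ℝ) + 1)⁻¹ * M₀) * (4 * D + ((n : ℝ) + 1) * ‖waveVec L m‖ ^ 4 *
      (2 - ((n : ℝ) + 1)⁻¹ * M₀)) = 4 * M₀ * D + 2 * κ ^ 2 * ((n : ℝ) + 1) * M₀ - κ ^ 2 * M₀ ^ 2 := by
    calc ((n : ℝ) + 1) * (((n : ℝ) + 1)⁻¹ * M₀) * (4 * D + ((n : ℝ) + 1) * ‖waveVec L m‖ ^ 4 *
          (2 - ((n : ℝ) + 1)⁻¹ * M₀))
        = (((n : ℝ) + 1) * ((n : ℝ) + 1)⁻¹) * M₀ * (4 * D + (‖waveVec L m‖ ^ 2) ^ 2 *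
            (2 * ((n : ℝ) + 1) - (((n : ℝ) + 1) * ((n : ℝ) + 1)⁻¹) * M₀)) := by ring
      _ = 4 * M₀ * D + 2 * κ ^ 2 * ((n : ℝ) + 1) * M₀ - κ ^ 2 * M₀ ^ 2 := by rw [hNinv, ← hκ]; ring
  rw [hR]
  nlinarith [hCS, hJ2]

end Summit.AtomisticToContinuum.BoseEinsteinCondensation.Cruxes.HardCoreExtension.ThirdLawCurrentFloor

end
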